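import Summits.Ventures.PercRepro.RankLevelSetHallRuleLPavingCount
import Summits.Ventures.PercRepro.RankLevelSetHallRuleLBound
import Summits.Ventures.PercRepro.RankLevelSetHallRuleLUniform

/-!
# PercRepro — RULE L PAYS EVERY MEMBER WHOSE CLOSURE IS A PAVING FLAT (p4, gen 31; C-044, UP form at the tight layer;
paper proofs/P4-CELL-THREE.md §14.14)

The uniform-flat theorem (RankLevelSetHallRuleLUniform, `ruleL_pays_of_uniform_flat`) needs every `≤ q`-subset of
`cl Z` independent.  THIS FILE weakens the hypothesis to PAVING — every `≤ (q−1)`-subset of `cl Z` independent — and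
still proves that night-1's Rule L pays the member `Z` at the tight layer (`q + 2 ≤ p`), through the `k`-bounded-eligibility
criterion `ruleL_pays_of_bound` with `c = k = p − q`: on a big set `S = Z ∪ X_P ∪ Y` (`X_P ⊆ flatPart Z` nonempty, `Y` a
free `(k−1)`-set with `Z ∪ Y` independent) a member `Z′ = A ∪ T` (`A ⊆ G := Z ∪ X_P`, `T = Z′ ∩ Y`)
* with `#T ≥ 2` is never eligible (`not_eligible_of_inter_free_of_uniform`: `#A ≤ q − 2`, so `A ∪ {e}` is independent for
  every `e ∈ G` by paving and stays so with `T` by submodularity; `e ∈ Y` is handled the same way);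
* with `#T = 1`, `Z′ = A ∪ {d}`, is eligible only if `A` is a BAD `(q−1)`-subset of `G` — not closed in `G`
  (`bad_of_eligible_of_inter_free`);
* with `T = ∅` is one of the `≤ C(#G, q)` members inside `G`.
So `eligCount S ≤ C(q + a, q) + #Y · #bad(G)` (`eligCount_le_of_paving`), and the bad-set count
`#bad(G) ≤ C(#G, q)` of RankLevelSetHallRuleLPavingCount gives `eligCount S ≤ (1 + (k − 1)) · C(q + a, q) = k · C(q + a, q)`.
**`ruleL_pays_of_paving_flat`**: `Φ(p,q) ≤ ruleLRecv Z` for every member with a paving closure-flat; the uniform case is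
the special case `q = 0` or `(U_q) ⇒ (U_{q−1})`.  Axioms standard.
-/

namespace PercRepro

open Set Matroid Finset

variable {α : Type} (M : Matroid α) [M.Finite]

/-- Under `(U_u)` — every subset of `cl Z` with at most `u` elements is independent — a member `Z′` of
`S = Z ∪ X_P ∪ X_D` that meets `X_D` in at least `q + 1 − u` points is not eligible in `S`: every `insert e Z′`,
`e ∈ S ∖ Z′`, is independent.  (`u = q`: RankLevelSetHallRuleLUniformTools; `u = q − 1`: the paving case.) -/
lemma not_eligible_of_inter_free_of_uniform {p q u : ℕ} (hE : M.E.ncard = p + q) {Z X_P X_D : Set α}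
    (hZ : Z ∈ cellMembers M p q) (hU : ∀ A ⊆ M.closure Z, A.ncard ≤ u → M.Indep A)
    (hXP : X_P ⊆ flatPart M Z) (hXD : X_D ⊆ M.E \ M.closure Z) (hZXD : M.Indep (Z ∪ X_D))
    {Z' : Set α} (hZ' : Z' ∈ cellMembers M p q) (hZ'S : Z' ⊆ Z ∪ X_P ∪ X_D)
    (hmeet : q + 1 ≤ u + (Z' ∩ X_D).ncard) :
    ¬ ∃ e ∈ Z ∪ X_P ∪ X_D, e ∉ Z' ∧ M.eRk (insert e Z') = (q : ℕ∞) := by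
  rintro ⟨e, heS, heZ', hrk⟩
  have hZE : Z ⊆ M.E := hZ.1
  have hZ'E : Z' ⊆ M.E := hZ'.1
  have hZ'card : Z'.ncard = q := ncard_eq_q_of_mem_cellMembers_tight M hE hZ'
  have hZ'fin : Z'.Finite := M.set_finite Z' hZ'E
  have hZ'ind : M.Indep Z' := by
    rw [indep_iff_eRk_eq_encard_of_finite hZ'fin, hZ'.2.1, ← hZ'fin.cast_ncard_eq, hZ'card]
  have hXPcl : X_P ⊆ M.closure Z := fun x hx => (hXP hx).2
  set A := Z' \ X_D with hA
  set T := Z' ∩ X_D with hT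
  have hAcl : A ⊆ M.closure Z := by
    intro x hx
    rcases hZ'S hx.1 with (hxZ | hxP) | hxD
    · exact M.subset_closure Z hZE hxZ
    · exact hXPcl hxP
    · exact absurd hxD hx.2
  have hAT : A ∪ T = Z' := by
    ext x
    constructor
    · rintro (hx | hx)
      · exact hx.1
      · exact hx.1
    · intro hx
      by_cases hxD : x ∈ X_D
      · exact Or.inr ⟨hx, hxD⟩
      · exact Or.inl ⟨hx, hxD⟩
  have hAind : M.Indep A := hZ'ind.subset Set.sdiff_subset
  have hAfin : A.Finite := hZ'fin.subset Set.sdiff_subset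
  have hTfin : T.Finite := hZ'fin.subset Set.inter_subset_left
  have hAT' : Disjoint A T := Set.disjoint_left.2 (fun x hxA hxT => hxA.2 hxT.2)
  have hAcard : A.ncard + T.ncard = q := by
    rw [← Set.ncard_union_eq hAT' hAfin hTfin, hAT, hZ'card]
  have hTX : T ⊆ X_D := Set.inter_subset_right
  -- insert e Z' is independent
  have hins : M.Indep (insert e Z') := by
    have hclcase : e ∈ M.closure Z → M.Indep (insert e Z') := by
      intro hecl
      have hAe : M.Indep (insert e A) := by
        refine hU _ (Set.insert_subset hecl hAcl) ?_
        rw [Set.ncard_insert_of_notMem (fun h => heZ' h.1) hAfin]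
        omega
      have := indep_union_of_subset_closure M hZXD hXD hAe (Set.insert_subset hecl hAcl) hTX
      rw [Set.insert_union, hAT] at this
      exact this
    rcases heS with (heZ | heP) | heD
    · exact hclcase (M.subset_closure Z hZE heZ)
    · exact hclcase (hXPcl heP)
    · have := indep_union_of_subset_closure M hZXD hXD hAind hAcl
        (Set.insert_subset heD hTX : insert e T ⊆ X_D)
      rw [Set.union_insert, hAT] at this
      exact this
  -- then its rank is q + 1, not q
  have hrk' : M.eRk (insert e Z') = (insert e Z').encard := hins.eRk_eq_encard
  rw [Set.encard_insert_of_notMem heZ', ← hZ'fin.cast_ncard_eq, hZ'card, hrk] at hrk'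
  have hq : q = q + 1 := by exact_mod_cast hrk'
  omega

/-- **The `t = 1` analysis under paving**: if every `≤ (q−1)`-subset of `cl Z` is independent, an ELIGIBLE member `Z′` of
`S = Z ∪ X_P ∪ X_D` that meets `X_D` meets it in exactly one point, and `A := Z′ ∖ X_D` is a bad `(q−1)`-subset of
`G = Z ∪ X_P`: some `e ∈ G ∖ A` lies in `cl A`. -/
lemma bad_of_eligible_of_inter_free {p q : ℕ} (hE : M.E.ncard = p + q) (hq : 1 ≤ q) {Z X_P X_D : Set α}
    (hZ : Z ∈ cellMembers M p q) (hU : ∀ A ⊆ M.closure Z, A.ncard ≤ q - 1 → M.Indep A)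
    (hXP : X_P ⊆ flatPart M Z) (hXD : X_D ⊆ M.E \ M.closure Z) (hZXD : M.Indep (Z ∪ X_D))
    {Z' : Set α} (hZ' : Z' ∈ cellMembers M p q) (hZ'S : Z' ⊆ Z ∪ X_P ∪ X_D) (hmeet : (Z' ∩ X_D).Nonempty)
    (helig : ∃ e ∈ Z ∪ X_P ∪ X_D, e ∉ Z' ∧ M.eRk (insert e Z') = (q : ℕ∞)) :
    (Z' ∩ X_D).ncard = 1 ∧ (Z' \ X_D).ncard = q - 1 ∧
      ∃ e ∈ Z ∪ X_P, e ∉ Z' \ X_D ∧ e ∈ M.closure (Z' \ X_D) := by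
  have hZE : Z ⊆ M.E := hZ.1
  have hZ'E : Z' ⊆ M.E := hZ'.1
  have hZ'card : Z'.ncard = q := ncard_eq_q_of_mem_cellMembers_tight M hE hZ'
  have hZ'fin : Z'.Finite := M.set_finite Z' hZ'E
  have hZ'ind : M.Indep Z' := by
    rw [indep_iff_eRk_eq_encard_of_finite hZ'fin, hZ'.2.1, ← hZ'fin.cast_ncard_eq, hZ'card]
  have hXPcl : X_P ⊆ M.closure Z := fun x hx => (hXP hx).2
  set A := Z' \ X_D with hA
  set T := Z' ∩ X_D with hT
  have hAcl : A ⊆ M.closure Z := by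
    intro x hx
    rcases hZ'S hx.1 with (hxZ | hxP) | hxD
    · exact M.subset_closure Z hZE hxZ
    · exact hXPcl hxP
    · exact absurd hxD hx.2
  have hAT : A ∪ T = Z' := by
    ext x
    constructor
    · rintro (hx | hx)
      · exact hx.1
      · exact hx.1
    · intro hx
      by_cases hxD : x ∈ X_D
      · exact Or.inr ⟨hx, hxD⟩
      · exact Or.inl ⟨hx, hxD⟩
  have hAind : M.Indep A := hZ'ind.subset Set.sdiff_subset
  have hAfin : A.Finite := hZ'fin.subset Set.sdiff_subset
  have hTfin : T.Finite := hZ'fin.subset Set.inter_subset_left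
  have hAT' : Disjoint A T := Set.disjoint_left.2 (fun x hxA hxT => hxA.2 hxT.2)
  have hAcard : A.ncard + T.ncard = q := by
    rw [← Set.ncard_union_eq hAT' hAfin hTfin, hAT, hZ'card]
  have hTX : T ⊆ X_D := Set.inter_subset_right
  have hTpos : 1 ≤ T.ncard := by
    have : 0 < T.ncard := (Set.ncard_pos hTfin).2 hmeet
    omega
  -- t = 1: otherwise the uniform lemma with u = q − 1 forbids eligibility
  have hT1 : T.ncard = 1 := by
    by_contra hne
    exact not_eligible_of_inter_free_of_uniform M hE hZ hU hXP hXD hZXD hZ' hZ'S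
      (show q + 1 ≤ q - 1 + (Z' ∩ X_D).ncard by rw [← hT]; omega) helig
  refine ⟨hT1, by omega, ?_⟩
  obtain ⟨e, heS, heZ', hrk⟩ := helig
  -- insert e Z' is NOT independent (its rank would be q + 1)
  have hnotind : ¬ M.Indep (insert e Z') := by
    intro hins
    have hrk' : M.eRk (insert e Z') = (insert e Z').encard := hins.eRk_eq_encard
    rw [Set.encard_insert_of_notMem heZ', ← hZ'fin.cast_ncard_eq, hZ'card, hrk] at hrk'
    have hq' : q = q + 1 := by exact_mod_cast hrk'
    omega
  rcases heS with heG | heD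
  · refine ⟨e, heG, fun h => heZ' h.1, ?_⟩
    by_contra hecl
    apply hnotind
    have heE : e ∈ M.E := by
      rcases heG with heZ | heP
      · exact hZE heZ
      · exact (hXP heP).1.1
    have hAe : M.Indep (insert e A) :=
      (hAind.insert_indep_iff_of_notMem (fun h => heZ' h.1)).2 ⟨heE, hecl⟩
    have hecl' : e ∈ M.closure Z := by
      rcases heG with heZ | heP
      · exact M.subset_closure Z hZE heZ
      · exact hXPcl heP
    have := indep_union_of_subset_closure M hZXD hXD hAe (Set.insert_subset hecl' hAcl) hTX
    rw [Set.insert_union, hAT] at this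
    exact this
  · exfalso
    apply hnotind
    have := indep_union_of_subset_closure M hZXD hXD hAind hAcl
      (Set.insert_subset heD hTX : insert e T ⊆ X_D)
    rw [Set.union_insert, hAT] at this
    exact this

/-- **The eligibility bound under paving**: `eligCount (Z ∪ X_P ∪ X_D) ≤ C(#(Z ∪ X_P), q) + #X_D · C(#(Z ∪ X_P), q)` —
the members inside `G = Z ∪ X_P` and, for each `d ∈ X_D`, one member `A ∪ {d}` per bad `(q−1)`-subset `A` of `G`,
of which there are at most `C(#G, q)` (`card_badSets_le_choose`). -/
theorem eligCount_le_of_paving {p q : ℕ} (hE : M.E.ncard = p + q) (hq : 1 ≤ q) {Z X_P X_D : Set α}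
    (hZ : Z ∈ cellMembers M p q) (hU : ∀ A ⊆ M.closure Z, A.ncard ≤ q - 1 → M.Indep A)
    (hXP : X_P ⊆ flatPart M Z) (hXD : X_D ⊆ M.E \ M.closure Z) (hZXD : M.Indep (Z ∪ X_D)) :
    eligCount M p q (Z ∪ X_P ∪ X_D) ≤ (Z ∪ X_P).ncard.choose q + X_D.ncard * (Z ∪ X_P).ncard.choose q := by
  classical
  have hZE : Z ⊆ M.E := hZ.1
  have hEfin : M.E.Finite := M.ground_finite
  have hGE : Z ∪ X_P ⊆ M.E := Set.union_subset hZE (fun x hx => (hXP hx).1.1)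
  have hGfin : (Z ∪ X_P).Finite := hEfin.subset hGE
  have hXDE : X_D ⊆ M.E := fun x hx => (hXD hx).1
  have hXDfin : X_D.Finite := hEfin.subset hXDE
  have hGcl : Z ∪ X_P ⊆ M.closure Z := Set.union_subset (M.subset_closure Z hZE) (fun x hx => (hXP hx).2)
  -- the finset G and its bad sets
  set Gf : Finset α := hGfin.toFinset with hGf
  have hGfcoe : (Gf : Set α) = Z ∪ X_P := hGfin.coe_toFinset
  have hGfcard : Gf.card = (Z ∪ X_P).ncard := (Set.ncard_eq_toFinset_card _ hGfin).symm
  have hbad : (badSets M q Gf).card ≤ Gf.card.choose q := by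
    refine card_badSets_le_choose M hq (by rw [hGfcoe]; exact hGE) ?_ ?_
    · rw [hGfcoe]
      apply le_antisymm
      · calc M.eRk (Z ∪ X_P) ≤ M.eRk (M.closure Z) := M.eRk_mono hGcl
          _ = M.eRk Z := M.eRk_closure_eq Z
          _ = (q : ℕ∞) := hZ.2.1
      · calc (q : ℕ∞) = M.eRk Z := hZ.2.1.symm
          _ ≤ M.eRk (Z ∪ X_P) := M.eRk_mono Set.subset_union_left
    · intro A hAG hAcard
      refine hU (A : Set α) ((Finset.coe_subset.2 hAG).trans (hGfcoe ▸ hGcl)) ?_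
      rw [Set.ncard_coe_finset]
      exact hAcard
  -- the eligible members: inside G, or of the form insert d A with A bad and d ∈ X_D
  set E := {Z' : Set α | Z' ∈ cellMembers M p q ∧ Z' ⊆ Z ∪ X_P ∪ X_D ∧
    ∃ e ∈ Z ∪ X_P ∪ X_D, e ∉ Z' ∧ M.eRk (insert e Z') = (q : ℕ∞)} with hEdef
  set E₀ := {Z' : Set α | Z' ∈ cellMembers M p q ∧ Z' ⊆ Z ∪ X_P} with hE₀
  let f : Finset α × α → Set α := fun x => insert x.2 (x.1 : Set α)
  set P : Set (Finset α × α) := (↑(badSets M q Gf) : Set (Finset α)) ×ˢ X_D with hP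
  have hPfin : P.Finite := (Finset.finite_toSet _).prod hXDfin
  have hE₀fin : E₀.Finite := (cellMembers_finite M p q).subset (fun _ h => h.1)
  have hsplit : E ⊆ E₀ ∪ f '' P := by
    intro Z' hZ'
    obtain ⟨hmem, hsub, helig⟩ := hZ'
    by_cases hZ'G : Z' ⊆ Z ∪ X_P
    · exact Or.inl ⟨hmem, hZ'G⟩
    · right
      have hmeet : (Z' ∩ X_D).Nonempty := by
        rw [Set.nonempty_iff_ne_empty]
        intro hempty
        apply hZ'G
        intro x hx
        rcases hsub hx with hxG | hxD
        · exact hxG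
        · exact absurd (show x ∈ Z' ∩ X_D from ⟨hx, hxD⟩) (by rw [hempty]; exact id)
      obtain ⟨hT1, hAcard, e, heG, heA, hecl⟩ :=
        bad_of_eligible_of_inter_free M hE hq hZ hU hXP hXD hZXD hmem hsub hmeet helig
      obtain ⟨d, hd⟩ := Set.ncard_eq_one.1 hT1
      have hZ'fin : Z'.Finite := hEfin.subset hmem.1
      have hAfin : (Z' \ X_D).Finite := hZ'fin.subset Set.sdiff_subset
      set Af : Finset α := hAfin.toFinset with hAf
      have hAfcoe : (Af : Set α) = Z' \ X_D := hAfin.coe_toFinset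
      refine ⟨(Af, d), ?_, ?_⟩
      · rw [hP, Set.mem_prod]
        refine ⟨?_, ?_⟩
        · rw [Finset.mem_coe, mem_badSets]
          refine ⟨⟨?_, ?_⟩, e, ?_, ?_, ?_⟩
          · intro x hx
            rw [hAf, hAfin.mem_toFinset] at hx
            rw [hGf, hGfin.mem_toFinset]
            rcases hsub hx.1 with hxG | hxD
            · exact hxG
            · exact absurd hxD hx.2
          · rw [hAf, ← Set.ncard_eq_toFinset_card _ hAfin, hAcard]
          · rw [hGf, hGfin.mem_toFinset]; exact heG
          · rw [hAf, hAfin.mem_toFinset]; exact heA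
          · rw [hAfcoe]; exact hecl
        · have : d ∈ Z' ∩ X_D := by rw [hd]; exact Set.mem_singleton d
          exact this.2
      · show insert d (Af : Set α) = Z'
        rw [hAfcoe, ← Set.singleton_union, ← hd, Set.union_comm, Set.sdiff_union_inter]
  -- counting
  have hEfin' : E.Finite := (cellMembers_finite M p q).subset (fun _ h => h.1)
  have h1 : E.ncard ≤ (E₀ ∪ f '' P).ncard :=
    Set.ncard_le_ncard hsplit (hE₀fin.union (hPfin.image f))
  have h2 : (E₀ ∪ f '' P).ncard ≤ E₀.ncard + (f '' P).ncard := Set.ncard_union_le _ _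
  have h3 : E₀.ncard ≤ (Z ∪ X_P).ncard.choose q := ncard_members_subset_le_choose M hE hGE
  have h4 : (f '' P).ncard ≤ P.ncard := Set.ncard_image_le hPfin
  have h5 : P.ncard = (badSets M q Gf).card * X_D.ncard := by
    rw [hP, Set.ncard_prod, Set.ncard_coe_finset]
  have h6 : (badSets M q Gf).card * X_D.ncard ≤ (Z ∪ X_P).ncard.choose q * X_D.ncard := by
    rw [← hGfcard]
    exact Nat.mul_le_mul_right _ hbad
  unfold eligCount
  calc E.ncard ≤ E₀.ncard + (f '' P).ncard := le_trans h1 h2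
    _ ≤ (Z ∪ X_P).ncard.choose q + (Z ∪ X_P).ncard.choose q * X_D.ncard := by
        have := le_trans h4 (h5 ▸ h6)
        omega
    _ = (Z ∪ X_P).ncard.choose q + X_D.ncard * (Z ∪ X_P).ncard.choose q := by ring

/-- **Rule L pays every member whose closure is a paving flat** (tight layer, `q + 2 ≤ p`): if every subset of `cl Z`
with at most `q − 1` elements is independent, then `Φ(p,q) ≤ ruleLRecv Z`.  The uniform-flat theorem is the case where
even the `q`-subsets are independent. -/
theorem ruleL_pays_of_paving_flat (p q : ℕ) (hE : M.E.ncard = p + q) (hpq : q + 2 ≤ p) {Z : Set α}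
    (hZ : Z ∈ cellMembers M p q) (hU : ∀ A ⊆ M.closure Z, A.ncard ≤ q - 1 → M.Indep A) :
    phiK p q ≤ ruleLRecv M p q Z := by
  rcases Nat.eq_zero_or_pos q with hq0 | hq
  · subst hq0
    exact ruleL_pays_of_uniform_flat M p 0 hE hpq hZ (by simpa using hU)
  refine ruleL_pays_of_bound M p q hE hpq hZ (p - q) (by omega) le_rfl ?_
  intro B hB hBcard hZB Y hY hYcard X_P hXP hne
  have hYD : Y ⊆ M.E \ M.closure Z := hY.trans hB
  have hZY : M.Indep (Z ∪ Y) := hZB.subset (Set.union_subset_union_right Z hY)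
  have h := eligCount_le_of_paving M hE hq hZ hU hXP hYD hZY
  -- #(Z ∪ X_P) = q + #X_P
  have hZE : Z ⊆ M.E := hZ.1
  have hEfin : M.E.Finite := M.ground_finite
  have hZfin : Z.Finite := hEfin.subset hZE
  have hXPfin : X_P.Finite := hEfin.subset (fun x hx => (hXP hx).1.1)
  have hdisj : Disjoint Z X_P := Set.disjoint_left.2 (fun x hxZ hxX => (hXP hxX).1.2 hxZ)
  have hcard : (Z ∪ X_P).ncard = q + X_P.ncard := by
    rw [Set.ncard_union_eq hdisj hZfin hXPfin, ncard_eq_q_of_mem_cellMembers_tight M hE hZ]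
  rw [hcard, hYcard] at h
  obtain ⟨k, hk⟩ : ∃ k, p - q = k + 1 := ⟨p - q - 1, by omega⟩
  have hk' : p - q - 1 = k := by omega
  rw [hk'] at h
  rw [hk]
  calc eligCount M p q (Z ∪ X_P ∪ Y)
      ≤ (q + X_P.ncard).choose q + k * (q + X_P.ncard).choose q := h
    _ = (k + 1) * (q + X_P.ncard).choose q := by ring

end PercRepro
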